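import Summits.QuantumFields.YangMills.Theorems.LuscherReductionTwistedTraceScalingBOCoreDefectPointwise
import Summits.QuantumFields.YangMills.Theorems.LuscherReductionTwistedTraceScalingBOCoreTransferInner
import HarnessLib

/-!
# The core defect for signed slow amplitudes — inner-core version

`…BOCoreDefectPointwise.core_transfer_defect_le` with the central quasimode hypothesis `hC1` restricted to the inner core
`‖linkEmbed v''‖ ≤ R_in` (`R_in ≤ R`) and the output direction `‖x'‖ ≤ R_in` — the form in which (C1) is delivered on schedule B
(`…BOCentralQuasimode.central_quasimode_record`, `R_in = r_f/12`).  The proof is that of `core_transfer_defect_le` with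
`colour_fpFibreTransfer_two_sided_inner` in place of `colour_fpFibreTransfer_two_sided`.
-/

set_option autoImplicit false

noncomputable section

open MeasureTheory Filter Topology Real
open scoped BigOperators
open Literature.MathematicalPhysics.QuantumFieldTheory
open Literature.MathematicalPhysics.QuantumLattice

namespace Summit.QuantumFields.YangMills.Theorems.FemtoTransferGap.TwoLattice.ConstTube

open Summit.QuantumFields.YangMills.Theorems.FemtoTransferGap
open Summit.QuantumFields.YangMills.Theorems.FemtoTransferGap.TwoLattice
open Summit.QuantumFields.YangMills.Theorems.FemtoTransferGap.TwoLattice.Avg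
open Summit.QuantumFields.YangMills.Theorems.FemtoTransferGap.TwoLattice.Stiff (LinkSpace)

variable {L : ℕ} [NeZero L]

/-- ★★★ **THE CORE DEFECT FOR SIGNED SLOW AMPLITUDES, INNER-CORE VERSION**: `core_transfer_defect_le` verbatim except that the central
quasimode hypothesis `hC1` is required only on `‖linkEmbed ·‖ ≤ R_in ≤ R` and the output direction satisfies `‖x'‖ ≤ R_in`
(via `…BOCoreTransferInner.colour_fpFibreTransfer_two_sided_inner`; hypotheses as in `colour_fpFibreTransfer_two_sided`, plus `c₁ ≥ 0`, `P ≥ 0`, and `φ` bounded measurable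
supported in the `δu`-window with one-site action `≤ σ/L³`). [cite: Luscher1983, §3] -/
theorem core_transfer_defect_le_inner {β : ℝ} (hβ : 0 ≤ β) {Ω : LinkSpace L → ℝ} (hΩm : Measurable Ω) {CΩ : ℝ} (hCΩ : ∀ x, |Ω x| ≤ CΩ) (hΩ0 : ∀ x, 0 ≤ Ω x)
    {W : (Site 3 L → SU2) → ℝ} (hW : Measurable W) {CW : ℝ} (hCW : ∀ g, |W g| ≤ CW) (hW0 : ∀ g, 0 ≤ W g)
    {δ δu T R Γ σ : ℝ} (hδ1 : δ ≤ 1 / 2) (hα1 : δ + δu ≤ 1) (hT0 : 0 ≤ T) (hT : T ≤ 1 / 30) (hσ : σ < 2)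
    (hΩt : ∀ v : Edge 3 L → Fin 3 → ℝ, Ω (linkEmbed L v) ≠ 0 → v ∈ capBalancedSet L ∧ (∀ (e : Edge 3 L) (c : Fin 3), |v e c| ≤ T) ∧ ‖linkEmbed L v‖ ≤ R)
    (hWc : ∀ g : Site 3 L → SU2, W g ≠ 0 → (∀ x, ‖su2Quat (g x) - 1‖ ≤ T) ∧ ‖∑ x, vecPart (g x)‖ ≤ Γ)
    {P : LinkSpace L → ℝ} (hP0 : ∀ x, 0 ≤ P x) (hPinv : ∀ (g : SU2) (x : LinkSpace L), P (adL L g x) = P x) {c₁ ηc Rin : ℝ} (hc₁ : 0 ≤ c₁)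
    (hRin : Rin ≤ R)
    (hC1 : ∀ v'' : Edge 3 L → Fin 3 → ℝ, v'' ∈ capBalancedSet L → (∀ (e : Edge 3 L) (a : Fin 3), |v'' e a| ≤ T) → ‖linkEmbed L v''‖ ≤ Rin →
      |fpFibreTransfer L β Ω W (orthoTube L 1 v'') 1 - c₁ * P (linkEmbed L v'')| ≤ ηc * (c₁ * P (linkEmbed L v'')))
    (u' : GaugeConfig 3 1 SU2) (hu' : ∀ k : Fin 3, ‖su2Quat (u' (0, k)) - 1‖ ≤ δ) (hS' : (L : ℝ) ^ 3 * wilsonAction su2Rep u' ≤ σ)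
    {v' : Edge 3 L → Fin 3 → ℝ} (hv' : v' ∈ capBalancedSet L) (hv'T : ∀ e : Edge 3 L, ∑ a, v' e a ^ 2 ≤ T ^ 2) (hx' : ‖linkEmbed L v'‖ ≤ Rin)
    {φ : GaugeConfig 3 1 SU2 → ℝ} (hφm : Measurable φ) {Cφ : ℝ} (hCφ : ∀ u, |φ u| ≤ Cφ)
    (hφw : ∀ u, φ u ≠ 0 → (∀ k : Fin 3, ‖su2Quat (u (0, k)) - 1‖ ≤ δu) ∧ (L : ℝ) ^ 3 * wilsonAction su2Rep u ≤ σ) :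
    |(∫ u, φ u * (∫ c, fpFibreTransfer L β Ω W (gaugeTransform (fun _ : Site 3 L => c⁻¹) (orthoTube L u' v')) u ∂haarProbability SU2) ∂configMeasure SU2 1) -
        c₁ * P (linkEmbed L v') *
          ∫ u, φ u * (avgKernel ((L : ℝ) ^ 3 * β) u' u / transferKernel su2Rep ((L : ℝ) ^ 3 * β) (1 : GaugeConfig 3 1 SU2) 1) ∂configMeasure SU2 1| ≤
      max (1 - Real.exp (-(coreEta L β δ (δ + δu) T R Γ σ + coreEps1 L β δ T R + coreEps2 L β δ T R σ)) * (1 - ηc))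
          (Real.exp (coreEta L β δ (δ + δu) T R Γ σ + coreEps1 L β δ T R + coreEps2 L β δ T R σ) * (1 + ηc) - 1) *
        (c₁ * P (linkEmbed L v') *
          ∫ u, |φ u| * (avgKernel ((L : ℝ) ^ 3 * β) u' u / transferKernel su2Rep ((L : ℝ) ^ 3 * β) (1 : GaugeConfig 3 1 SU2) 1) ∂configMeasure SU2 1) := by
  set B : ℝ := (L : ℝ) ^ 3 * β with hB
  set η : ℝ := coreEta L β δ (δ + δu) T R Γ σ + coreEps1 L β δ T R + coreEps2 L β δ T R σ with hη
  set A : ℝ := c₁ * P (linkEmbed L v') with hA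
  set ε : ℝ := max (1 - Real.exp (-η) * (1 - ηc)) (Real.exp η * (1 + ηc) - 1) with hε
  set I : GaugeConfig 3 1 SU2 → ℝ := fun u => ∫ c, fpFibreTransfer L β Ω W (gaugeTransform (fun _ : Site 3 L => c⁻¹) (orthoTube L u' v')) u ∂haarProbability SU2 with hI
  set ρ : GaugeConfig 3 1 SU2 → ℝ := fun u => avgKernel B u' u / transferKernel su2Rep B (1 : GaugeConfig 3 1 SU2) 1 with hρ
  have hA0 : 0 ≤ A := mul_nonneg hc₁ (hP0 _)
  have hK1 : 0 < transferKernel su2Rep B (1 : GaugeConfig 3 1 SU2) 1 := transferKernel_pos _ _ _ _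
  have hρ0 : ∀ u, 0 ≤ ρ u := fun u => div_nonneg (avgKernel_pos B _ _).le hK1.le
  have hCφ0 : 0 ≤ Cφ := (abs_nonneg _).trans (hCφ 1)
  -- pointwise defect in `u`
  have hpt : ∀ u, |φ u * I u - A * (φ u * ρ u)| ≤ ε * (A * (|φ u| * ρ u)) := by
    intro u
    by_cases hu : φ u = 0
    · rw [hu]; simp
    · obtain ⟨huw, hSu⟩ := hφw u hu
      have h2 := colour_fpFibreTransfer_two_sided_inner hβ hΩm hCΩ hΩ0 hW hCW hW0 hδ1 hα1 hT0 hT hσ hΩt hWc hPinv hRin hC1 u' u hu' hS' huw hSu hv' hv'T hx'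
      rw [← hB, ← hη] at h2
      obtain ⟨hlo, hhi⟩ := h2
      have hAρ : 0 ≤ A * ρ u := mul_nonneg hA0 (hρ0 u)
      -- `|I u − Aρ u| ≤ ε·Aρ u`
      have hd : |I u - A * ρ u| ≤ ε * (A * ρ u) := by
        rw [abs_le]
        constructor
        · have h1 : (1 - Real.exp (-η) * (1 - ηc)) * (A * ρ u) ≤ ε * (A * ρ u) := mul_le_mul_of_nonneg_right (le_max_left _ _) hAρ
          have h2' : Real.exp (-η) * (1 - ηc) * (A * ρ u) ≤ I u := by rw [hI, hA, hρ]; exact hlo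
          nlinarith
        · have h1 : (Real.exp η * (1 + ηc) - 1) * (A * ρ u) ≤ ε * (A * ρ u) := mul_le_mul_of_nonneg_right (le_max_right _ _) hAρ
          have h2' : I u ≤ Real.exp η * (1 + ηc) * (A * ρ u) := by rw [hI, hA, hρ]; exact hhi
          nlinarith
      calc |φ u * I u - A * (φ u * ρ u)| = |φ u| * |I u - A * ρ u| := by rw [← abs_mul]; ring_nf
        _ ≤ |φ u| * (ε * (A * ρ u)) := mul_le_mul_of_nonneg_left hd (abs_nonneg _)
        _ = ε * (A * (|φ u| * ρ u)) := by ring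
  -- integrability
  obtain ⟨BI, hBI⟩ := abs_colour_fpFibreTransfer_le (L := L) β hCΩ hCW (orthoTube L u' v')
  have hIm : Measurable I := measurable_colour_fpFibreTransfer β hΩm hW (orthoTube L u' v')
  obtain ⟨M1, hM10, hM1⟩ := exists_avgKernel_le (L := 1) B
  have hρm : Measurable ρ := (measurable_avgKernel_right (L := 1) B u').div_const _
  have hρb : ∀ u, |ρ u| ≤ M1 / transferKernel su2Rep B (1 : GaugeConfig 3 1 SU2) 1 := fun u => by
    rw [abs_of_nonneg (hρ0 u)]; exact div_le_div_of_nonneg_right (hM1 _ _) hK1.le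
  have iφI : Integrable (fun u => φ u * I u) (configMeasure SU2 1) :=
    integrable_of_measurable_abs_le _ (hφm.mul hIm) (C := Cφ * BI) fun u => by rw [abs_mul]; exact mul_le_mul (hCφ u) (hBI u) (abs_nonneg _) hCφ0
  have iφρ : Integrable (fun u => φ u * ρ u) (configMeasure SU2 1) :=
    integrable_of_measurable_abs_le _ (hφm.mul hρm) (C := Cφ * (M1 / transferKernel su2Rep B (1 : GaugeConfig 3 1 SU2) 1)) fun u => by
      rw [abs_mul]; exact mul_le_mul (hCφ u) (hρb u) (abs_nonneg _) hCφ0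
  have iaφρ : Integrable (fun u => |φ u| * ρ u) (configMeasure SU2 1) :=
    integrable_of_measurable_abs_le _ (hφm.abs.mul hρm) (C := Cφ * (M1 / transferKernel su2Rep B (1 : GaugeConfig 3 1 SU2) 1)) fun u => by
      rw [abs_mul, abs_abs]; exact mul_le_mul (hCφ u) (hρb u) (abs_nonneg _) hCφ0
  -- integrate
  have hIdef : (∫ u, φ u * (∫ c, fpFibreTransfer L β Ω W (gaugeTransform (fun _ : Site 3 L => c⁻¹) (orthoTube L u' v')) u ∂haarProbability SU2) ∂configMeasure SU2 1) =
      ∫ u, φ u * I u ∂configMeasure SU2 1 := rfl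
  have hρdef : ∫ u, φ u * (avgKernel B u' u / transferKernel su2Rep B (1 : GaugeConfig 3 1 SU2) 1) ∂configMeasure SU2 1 = ∫ u, φ u * ρ u ∂configMeasure SU2 1 := rfl
  have hρdef' : ∫ u, |φ u| * (avgKernel B u' u / transferKernel su2Rep B (1 : GaugeConfig 3 1 SU2) 1) ∂configMeasure SU2 1 = ∫ u, |φ u| * ρ u ∂configMeasure SU2 1 := rfl
  rw [hIdef, hρdef, hρdef', ← integral_const_mul, ← integral_sub iφI (iφρ.const_mul A), ← integral_const_mul, ← integral_const_mul]
  calc |∫ u, φ u * I u - A * (φ u * ρ u) ∂configMeasure SU2 1| ≤ ∫ u, |φ u * I u - A * (φ u * ρ u)| ∂configMeasure SU2 1 := abs_integral_le_integral_abs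
    _ ≤ ∫ u, ε * (A * (|φ u| * ρ u)) ∂configMeasure SU2 1 :=
        integral_mono_of_nonneg (ae_of_all _ fun _ => abs_nonneg _) ((iaφρ.const_mul A).const_mul ε) (ae_of_all _ hpt)

end Summit.QuantumFields.YangMills.Theorems.FemtoTransferGap.TwoLattice.ConstTube

end
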